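import Summits.CriticalPhenomena.CardyFormulaZ2.Theses.CardyBoundaryCoulombGas

/-!
# Line `vesica-zero-free-perron-branch` — skeleton for the crux `CardyBoundaryCoulombGas.StripClusterRates`
(crux item stmt-CriticalPhenomena-13878, rank 3, route `route-CriticalPhenomena-CardyBoundaryCoulombGas`)

Crux (FIXED, by name): `StripClusterRates` — in the free-wall axis-parallel strip `[0,m]×[0,n]` of
bond-`ℤ²` at `p = 1/2` the lengthwise rates `γₖ(n) = lim_m -log pₖ(m,n)/m` of "at least one spanning
cluster" (`p₁ = crossingProb half m n`) and of "two open LR crossings in distinct open clusters of the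
rectangle" (`p₂`) exist for every `n ≥ 1`, and `n·γ₁(n) → π/3 = π·h_{1,3}`, `n·γ₂(n) → 2π = π·h_{1,5}`.

Idea (card `Ideas/vesica-zero-free-perron-branch.md`, triage r1-1/2/3: pass; all three sharpenings
adopted).  The two constants are the `1/N` terms of the ground-state eigenvalues of the `d = 2` and
`d = 4` standard modules of the Temperley–Lieb (`β = 1`) double-row transfer tangle `D(u)` at the
isotropic point — Morin-Duchesne–Klümper–Pearce (MDKP, arXiv:1701.08167) compute exactly these by the
Klümper–Pearce method (`D₃` `T`- and `Y`-system, non-linear integral equations, Rogers dilogarithms: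
`Δ = d(d-1)/6`), with ONE non-rigorous input: the patterns of zeros / analyticity strips of §3.5
("formulated empirically … up to `N = 12`").  The lever cuts that input to size — what the NLIE uses
is zero-freeness of the sector Perron branch `Λ¹ = D¹`-eigenvalue in the CLOSED PHYSICAL STRIP
`0 ≤ Re u ≤ π/3` off its central line (the vesica `|p| ≤ 1, |p-1| ≤ 1` of the bond-probability plane)
plus zero-freeness of the fused branch `Λ² = D²`-eigenvalue in `|Re u| ≤ π/6` (MDKP's `1+K`, `1+d¹`
conditions), NOT MDKP's "edge line" idealisation, which is false at every finite `N` (triage F3/E3) —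
and proposes a mechanism: the `T`-system evaluated on `Re u = 0` is the exact identity
`|Λ¹(iy)|² = |f₁(iy)|² + Ψ(y)·Λ²(iy)` with `Ψ ≥ 0`, so `Λ² ≥ 0` on its central line SEALS the boundary
of the physical strip, after which the zero count inside is a homotopy invariant.

INSTANTIATION (a2) of the card, mandated by all three triagers: everything integrable is stated for
the DIAGONAL strip `{0 ≤ x - y ≤ N}` of `ℤ²`, whose two-bond-layer transfer matrix IS MDKP's `D(u)`
(BPO'B double-row tangle, vacuum boundaries; triage F2/E3 validated `D(0) = (-1)^N I`,
`D(π/2) = (-1/3)^N I`, crossing, commutation, RS branch, and the percolation rates digit for digit), and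
the two LIMITS are carried to the axis strip by DKKMO rotation invariance at `q = 1` + an
orientation-uniform RSW/Fekete sandwich (card `diagonal-strip-dkkmo-transfer`, triage: pass).  THE
FAMILY IS NAMED (triage r1-3 (1): the ideator's `∃ t` first lemma was vacuous): for real
`u ∈ (0, π/3)`, `D(u)/s₁(u)^{2N}` is the stochastic transfer matrix of COLUMN-STAGGERED anisotropic
bond percolation on the diagonal strip — bonds in even tile-columns open with probability
`p(u) = sin u / sin(u + π/3)`, in odd columns with `1 - p(u)` (triage F2) — so the sector Perron branch is
pinned, over existing declarations only (`prodBernoulli`, `openConnIn`, `bondPercolation`), as the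
unique entire function agreeing on `(0, π/3)` with `f₁(u)·exp(-γ◇ₖ(N; u))`, `γ◇ₖ(N; u)` the `k`-cluster
decay rate per double row of that model (`IsSectorPerronPair.aniso`).  No transfer matrix, link state
or TL algebra is (re)defined here; the functional relations are stated for the scalar branches in
CLEARED-DENOMINATOR form (Lean division is total), and as typed they force MDKP's exact values
`Λ¹(0) = Λ¹(π/3) = (-1)^N`, `Λ¹(π/2) = (-1/3)^N` and the four common real zeros `±π/6, ±π/3` of `Λ²`
(checked by hand, see `IsD3Pair`), which is the rigidity that makes the `∃` of S2 non-vacuous.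

THE LINE (6 registered stubs + the route's own support item `StripRatesExist` (stmt-13879) as an
admissible hypothesis, glued by `StripClusterRates_of`; `k ∈ {1,2}` clusters ↔ `d = 2k` defects,
`N = 2j` strands, Kac exponent `hₖ = k(2k-1)/3 = Δ_{1,2k+1}`):
* `stub_sectorPerronBranches` (S2; XL, known in print + identification) — for `k ∈ {1,2}` there is a
  family `(Λ¹ⱼ, Λ²ⱼ)_{j ≥ 2}` with `IsSectorPerronPair (2j) k`: Laurent polynomial in `e^{2iu}` of
  degree `N`, leading coefficient = braid scalar `D¹_∞ ∈ {-2, 1}` × `e^{4πiN/3}/3^N`, real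
  coefficients, crossing symmetry, the `D₃` `T`-system and closure of MDPR14/MDKP17 at `λ = π/3`, and
  the identification with the anisotropic (on `(0,π/3)`) and isotropic (at `π/6`, standard measure)
  diagonal-strip percolation rates.  Sources: BehrendPearceOBrien1996 (commuting double-row transfer
  matrices, crossing), MDPR14 = arXiv:1401.7750 (fusion hierarchy, `T`-system, closure, braid scalars —
  diagrammatic theorems), MDKP17 §3.1–3.5, Perron–Frobenius, the route's foreseen `RateIsGap`.
* `stub_fusedCentralNonneg` (S3a; M–L, new) — the fused branch is real and `≥ 0` on its central line
  `Re u = 0` (`t¹ = 0` with sign; MDKP §3.7; triage E3/F4: positive wherever resolved, `N ≤ 12`).  Via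
  the `T`-system identity above it seals `Re u ∈ {0, π/3}` against zeros of `Λ¹`.
* `stub_vesicaPattern` (S3b; L, HARDEST genuinely new stub = the card's C⁺) — given S3a: in the closed
  physical strip `Λ¹` vanishes only on `Re u = π/6`, with exactly `k` zeros of positive imaginary part,
  all simple (`t² = 1, 2`); `Λ²` vanishes in `|Re u| ≤ π/6` only at `±π/6` (simple); and for `k = 2`
  MDKP's subcase B (`1 + K ∼ κ' e^{-4|x|/3}`, `κ' > 0`).  Decidable exactly for each `N` (Sturm /
  resultants); verified `N ≤ 12` by three independent codes (triage).  Mechanism: sealing + homotopy.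
* `stub_scalingTBA` (S4; XL) — MDKP §3.6–3.7 made rigorous: for every family with S2 ∧ S3a ∧ S3b
  eventually in `j`, `2j · log(Λ¹ⱼ(π/6)/f₁(π/6)) → -2π hₖ` (no bulk/surface term at `β = 1`: `D_b = f₁`
  is the Razumov–Stroganov eigenvalue, `D_s = 1`).  Internal cut for the lead: scaling-NLIE
  well-posedness (card `scaling-tba-positive-logs`, with the triage repair of its `∃!`) → certified
  winding integers `k^j = j` → dilogarithm identity `𝒥 ∈ {4π²/3, 0}`.  Template: Kozlowski2018.
* `stub_rotatedStripComparison` (B1; L given the vendored DKKMO facts, which are theorems in print) —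
  at 45°, the axis events of `[0,rn]×[0,n]` and the diagonal events of aspect `r` at matched scale have
  asymptotically equal probabilities (`k = 1`: `dkkmo_crossing_rotation_invariance` = DKKMO Cor. 1.3 +
  discrete/continuum crossing comparison; `k = 2`: `dkkmo_rotation_invariance` (loop form) + a.s.
  continuity of the open/dual/open alternating 3-crossing event).
* `stub_feketeTransfer` (B2; L, provable now with tree RSW) — orientation-uniform Fekete sandwich
  (sub-multiplicativity by restriction/independence; `n`-uniform gluing constants: Harris–FKG through a
  top–bottom crossing for `k = 1`, arm-separation gluing for `k = 2`; a-priori `e^{-Cr}` RSW lower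
  bounds) and the squeeze `r → ∞`: diagonal limit + B1 + existence of axis rates ⇒ axis limit.
* `StripClusterRates_of : StripRatesExist → StripClusterRates` — kernel-checked composition (no
  `sorry` of its own): rates from the support item; branches from S2; S3a, S3b pointwise in `j`; S4;
  `log(Λ¹(π/6)/f₁(π/6)) = -γ◇ₖ(2j)` from the isotropic identification (`f₁(π/6) = (-4/3)^N ≠ 0`
  proved here); B2 with B1; `π·h₁ = π/3`, `π·h₂ = 2π`.
* PROVED in §1b (no `sorry`): the card's sealing identity as a theorem of the typed `T`-system —
  `noZero_imagAxis_of_fusedNonneg` / `noZero_boundary_of_fusedNonneg` (S3a's conclusion ⇒ `Λ¹ ≠ 0` on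
  `Re u ∈ {0, π/3}`) — and the rigidity witness `fused_uIso_eq_zero` (`Λ²(π/6) = 0` is FORCED by the typed
  relations, MDKP's common zero; answers the vacuity objection of triage r1-3 (1) in Lean).

Disproof.lean (cdisprove cycle 1, NO KILL) honoured: §1 — the crux has no droppable hypothesis, no
`_false_without_` theorem exists; §3 `not_kacLowerBoundEveryWidth₁/₂` (REFUTED "Kac at every
width") — no stub asserts a per-width inequality: `π/3`, `2π` appear only as `n → ∞` limits (S4's
`o(1/N)` and B2's squeeze), consistent with approach from below; §4 numerics (slopes → `3/π`,
`1/(2π)`; TL word `∏(1+e_even)∏(1+e_odd)` = the AXIS strip) — this is why nothing integrable is typed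
on the axis matrix (triage: `[B, H] ≠ 0`, the axis family does not commute); §6 near-misses untouched.
No landed Negative lemma exists for this crux (nothing to import); negatives index (stmt-0748,
stmt-6949, stmt-6952): unrelated objects.  Dead lines avoided: MDKP "edge-line" wording (cards
cubic-closure-perron-zeros / exact-vacuum-ysystem FAILED on it) appears nowhere — `VesicaPattern`
speaks only of the closed physical strips; real-rootedness / PF-sequence routes (refuted on
pgf-zeros-y-system) are not used; the Hamiltonian point `u → 0` is not used.
-/

noncomputable section

namespace Summit.CriticalPhenomena.CardyFormulaZ2.Cruxes.StripClusterRates.VesicaZeroFreePerronBranch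

open Filter Topology MeasureTheory
open scoped BigOperators Classical ComplexConjugate
open Literature.Probability.Percolation Literature.Probability.LatticeModels
open Summit.CriticalPhenomena.CardyFormulaZ2.Theses.CardyBoundaryCoulombGas

set_option linter.unusedVariables false

/-! ## §0 Objects, all over existing declarations -/

/-! ### Axis strip: the crux's two events -/

/-- The crux's second event, verbatim: two open LR crossings of `[0,m]×[0,n]` in distinct open clusters
of the rectangle. -/
def twoClusterEvent (m n : ℕ) : Set (BondConfig (Site 2)) :=
  {ω | ∃ x₁ ∈ (leftSide m n : Set (Site 2)), ∃ y₁ ∈ (rightSide m n : Set (Site 2)),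
    ∃ x₂ ∈ (leftSide m n : Set (Site 2)), ∃ y₂ ∈ (rightSide m n : Set (Site 2)),
      ω ∈ openConnIn (rectangle m n : Set (Site 2)) x₁ y₁ ∧
      ω ∈ openConnIn (rectangle m n : Set (Site 2)) x₂ y₂ ∧
      ω ∉ openConnIn (rectangle m n : Set (Site 2)) x₁ x₂}

/-- `pₖ(m,n)`, `k = 1`: `P_{1/2}[LR(m,n)]` (`crossingProb half m n`); `k ≠ 1` (used with `k = 2`):
`P_{1/2}[two LR crossings in distinct clusters]`. -/
def pAxis (k m n : ℕ) : ℝ :=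
  if k = 1 then crossingProb half m n else (bondPercolation (zdGraph 2) half).real (twoClusterEvent m n)

/-! ### Diagonal strip `{0 ≤ x - y ≤ N, 0 ≤ x + y ≤ 2M}` and its two events -/

/-- The diagonal strip of `N` tile-columns (`0 ≤ x - y ≤ N`, Euclidean width `N/√2`) and `M` double
rows (`0 ≤ x + y ≤ 2M`, Euclidean length `√2·M`); aspect ratio `2M/N`.  Its two-bond-layer transfer
matrix with free boundary is MDKP's double-row tangle `D(π/6)/(4/3)^N` on `N` strands (triage F2/E3). -/
def diagStrip (M N : ℕ) : Set (Site 2) :=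
  {v | 0 ≤ v 0 - v 1 ∧ v 0 - v 1 ≤ N ∧ 0 ≤ v 0 + v 1 ∧ v 0 + v 1 ≤ 2 * M}

/-- Bottom end of the diagonal strip: the level `x + y = 0`. -/
def diagBottom (M N : ℕ) : Set (Site 2) := {v | v ∈ diagStrip M N ∧ v 0 + v 1 = 0}

/-- Top end of the diagonal strip: the level `x + y = 2M`. -/
def diagTop (M N : ℕ) : Set (Site 2) := {v | v ∈ diagStrip M N ∧ v 0 + v 1 = 2 * M}

/-- At least one spanning cluster of the diagonal strip (an open bottom–top crossing inside it). -/
def diagOneEvent (M N : ℕ) : Set (BondConfig (Site 2)) :=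
  openCrossing (diagStrip M N) (diagBottom M N) (diagTop M N)

/-- Two bottom–top open crossings of the diagonal strip in distinct open clusters of the strip. -/
def diagTwoEvent (M N : ℕ) : Set (BondConfig (Site 2)) :=
  {ω | ∃ x₁ ∈ diagBottom M N, ∃ y₁ ∈ diagTop M N, ∃ x₂ ∈ diagBottom M N, ∃ y₂ ∈ diagTop M N,
      ω ∈ openConnIn (diagStrip M N) x₁ y₁ ∧ ω ∈ openConnIn (diagStrip M N) x₂ y₂ ∧
      ω ∉ openConnIn (diagStrip M N) x₁ x₂}

/-- The `k`-cluster event of the diagonal strip (`k = 1`, else `k = 2`). -/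
def diagEvent (k M N : ℕ) : Set (BondConfig (Site 2)) :=
  if k = 1 then diagOneEvent M N else diagTwoEvent M N

/-- The rate sequence `M ↦ -log μ[k-cluster event of the M × N diagonal strip]/M` (per double row). -/
def diagRateSeq (μ : Measure (BondConfig (Site 2))) (k N : ℕ) : ℕ → ℝ :=
  fun M ↦ -Real.log (μ.real (diagEvent k M N)) / (M : ℝ)

/-! ### The column-staggered anisotropic model = MDKP's commuting family `D(u)` for real `u` -/

/-- Tile-column of a lattice edge of `ℤ²`: `min (x - y)` over its endpoints (a horizontal edge
`{(x,y),(x+1,y)}` sits in column `x - y`, a vertical edge `{(x,y),(x,y+1)}` in column `x - y - 1`). -/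
def edgeCol : Sym2 (Site 2) → ℤ :=
  Sym2.lift ⟨fun v w ↦ min (v 0 - v 1) (w 0 - w 1), fun v w ↦ min_comm _ _⟩

/-- MDKP's bond variable `p(u) = s₀(u)/(s₀(u) + s₁(-u)) = sin u / sin(u + π/3)` (triage F2):
`p(π/6) = 1/2`, `p(π/3 - u) = 1 - p(u)`. -/
def bondParam (u : ℝ) : ℝ := Real.sin u / Real.sin (u + Real.pi / 3)

/-- Clamp a real number to the unit interval. -/
def toUnit (x : ℝ) : unitInterval := Set.projIcc (0 : ℝ) 1 zero_le_one x

/-- Edge weights of the column-staggered model at spectral parameter `u`: lattice edges in even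
tile-columns are open with probability `p(u)`, in odd ones with `1 - p(u)`; non-edges are closed.
For `u ∈ (0, π/3)` the two-layer transfer matrix of this model on the strip `{0 ≤ x - y ≤ N}` is
`D(u)/s₁(u)^{2N}` (BPO'B double row: lower faces at `u`, upper at `λ - u`; a tile's open-probability
depends only on its column parity — triage F2; either parity convention gives the same spectrum by the
reflection `x - y ↦ N - (x - y)`, `N` even). -/
def stagWeight (u : ℝ) : Sym2 (Site 2) → unitInterval := fun e ↦
  if e ∈ (zdGraph 2).edgeSet then
    (if Even (edgeCol e) then toUnit (bondParam u) else toUnit (1 - bondParam u))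
  else toUnit 0

/-! ### Trigonometric building blocks at `λ = π/3` (MDKP §3.1, §3.3) -/

/-- The crossing parameter `λ = π/3` as a complex number. -/
def lam : ℂ := ((Real.pi / 3 : ℝ) : ℂ)

/-- The isotropic point `u = λ/2 = π/6`. -/
def uIso : ℂ := ((Real.pi / 6 : ℝ) : ℂ)

/-- `s_j(u) = sin(u + jλ)/sin λ`. -/
def sk (j : ℤ) (u : ℂ) : ℂ := Complex.sin (u + (j : ℂ) * lam) / Complex.sin lam

/-- `f_j(u) = (-1)^N s_j(u)^{2N}` (MDKP eq. after (fushier)); `f₁ = f₋₂` is the Razumov–Stroganov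
eigenvalue = `(-1)^N ×` the total weight of a double row, `|f₁(π/6)| = (4/3)^N`. -/
def fk (N : ℕ) (j : ℤ) (u : ℂ) : ℂ := (-1) ^ N * sk j u ^ (2 * N)

/-- Braid scalar `D¹_∞` on the standard module with `d = 2k` defects (MDPR14; MDKP eq. (braid01/02)):
`-2` for `d = 2 ≡ 2 (mod 3)`, `1` for `d = 4 ≡ 1 (mod 3)`. -/
def braidConst (k : ℕ) : ℂ := if k = 1 then -2 else 1

/-- Kac exponent `hₖ = h_{1,2k+1} = k(2k-1)/3`: `h₁ = 1/3`, `h₂ = 2` (Cardy1998 eq. (bb); MDKP §3.7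
`Δ = d(d-1)/6`). -/
def kacExp (k : ℕ) : ℝ := (k : ℝ) * (2 * k - 1) / 3

/-! ### The predicates the stubs are stated over -/

/-- **Algebraic `D₃` structure of a sector pair** (`Λ¹` = eigenvalue branch of `D¹ = D`, `Λ²` = of the
fused `D²`, on `N` strands, sector `d = 2k`), all THEOREMS in print for the genuine branches:
* `laurent₁/₂`: Laurent polynomials in `z² = e^{2iu}` with powers in `[-N, N]` (MDKP §3.5: powers of
  `z` in `[-2N, 2N]`, period `π`); the coefficient of `e^{-2iNu}` of `Λ¹` is the braid scalar times the
  universal constant `e^{4πiN/3}/3^N` (checked on the RS eigenvalue `f₋₂`, whose braid scalar is `1`);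
* `real₁/₂`: real coefficients (`Λ(ū) = conj Λ(u)`); `crossing₁`: `Λ¹(λ - u) = Λ¹(u)`; `even₂`:
  `Λ²(-u) = Λ²(u)` (MDKP §3.1, §3.3);
* `tsystem`: MDKP eq. (tsys) at `n = 1`, `λ = π/3`, denominators cleared:
  `s₋₁(2u)s₁(2u)·(Λ¹(u)Λ¹(u+λ) - f₋₁f₁) = s₀(2u)²f₀·Λ²(u)` — as typed it forces the four common real
  zeros `Λ²(±π/6) = Λ²(±π/3) = 0` (MDKP §3.5);
* `closure`: the `(p,p') = (2,3)` closure `D³₀ = D¹₁ - 2f₋₁` inserted in the `n = 2` `T`-system: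
  `s₀(2u)s₂(2u)·Λ²(u)Λ²(u+λ) = s₁(2u)²·(f₋₁(u) - Λ¹(u+λ))²` (equivalently `d¹₀d¹₁ = (1+K₀)²`) — as
  typed it forces `Λ¹(0) = Λ¹(λ) = (-1)^N` and `Λ¹(π/2) = (-1/3)^N` (MDKP §3.1, §3.5). -/
structure IsD3Pair (N k : ℕ) (Λ₁ Λ₂ : ℂ → ℂ) : Prop where
  laurent₁ : ∃ c : ℤ → ℂ,
    (∀ u : ℂ, Λ₁ u = ∑ m ∈ Finset.Icc (-(N : ℤ)) (N : ℤ), c m * Complex.exp (2 * Complex.I * (m : ℂ) * u)) ∧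
    c (-(N : ℤ)) = braidConst k * Complex.exp (((4 * Real.pi * N / 3 : ℝ) : ℂ) * Complex.I) / 3 ^ N
  laurent₂ : ∃ c : ℤ → ℂ,
    ∀ u : ℂ, Λ₂ u = ∑ m ∈ Finset.Icc (-(N : ℤ)) (N : ℤ), c m * Complex.exp (2 * Complex.I * (m : ℂ) * u)
  real₁ : ∀ u : ℂ, Λ₁ (conj u) = conj (Λ₁ u)
  real₂ : ∀ u : ℂ, Λ₂ (conj u) = conj (Λ₂ u)
  crossing₁ : ∀ u : ℂ, Λ₁ (lam - u) = Λ₁ u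
  even₂ : ∀ u : ℂ, Λ₂ (-u) = Λ₂ u
  tsystem : ∀ u : ℂ,
    sk (-1) (2 * u) * sk 1 (2 * u) * (Λ₁ u * Λ₁ (u + lam) - fk N (-1) u * fk N 1 u) =
      sk 0 (2 * u) ^ 2 * fk N 0 u * Λ₂ u
  closure : ∀ u : ℂ,
    sk 0 (2 * u) * sk 2 (2 * u) * (Λ₂ u * Λ₂ (u + lam)) =
      sk 1 (2 * u) ^ 2 * (fk N (-1) u - Λ₁ (u + lam)) ^ 2

/-- **The sector Perron pair of the diagonal strip**, NAMED (triage r1-3 (1)): the `D₃` structure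
plus the identification of `Λ¹` with percolation —
* `aniso`: for every `u ∈ (0, π/3)` the `k`-cluster rate per double row of the column-staggered model
  `prodBernoulli (stagWeight u)` on the width-`N` diagonal strip exists and `Λ¹(u) = f₁(u)·e^{-rate}`
  (Perron–Frobenius on the `u`-independent positive eigenvector of the commuting family + the route's
  `RateIsGap`/`RateIsPerron` for the `k`-marked block; at `β = 1` the `k = 2` block's Perron value is
  that of `W₄` despite reducibility — triage F1, four independent numerical confirmations) — this pins
  `Λ¹` uniquely (identity theorem) and, through `tsystem`, `Λ²`;
* `iso`: the same at `u = π/6` for the STANDARD measure `bondPercolation (zdGraph 2) half`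
  (`p(π/6) = 1/2`), the clause the composition consumes. -/
structure IsSectorPerronPair (N k : ℕ) (Λ₁ Λ₂ : ℂ → ℂ) : Prop extends IsD3Pair N k Λ₁ Λ₂ where
  aniso : ∀ u : ℝ, u ∈ Set.Ioo 0 (Real.pi / 3) → ∃ γ : ℝ,
    Tendsto (diagRateSeq (prodBernoulli (stagWeight u)) k N) atTop (𝓝 γ) ∧
      Λ₁ (u : ℂ) = fk N 1 (u : ℂ) * ((Real.exp (-γ) : ℝ) : ℂ)
  iso : ∃ γ : ℝ, Tendsto (diagRateSeq (bondPercolation (zdGraph 2) half) k N) atTop (𝓝 γ) ∧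
    Λ₁ uIso = fk N 1 uIso * ((Real.exp (-γ) : ℝ) : ℂ)

/-- **Fused branch nonnegative on its central line** `Re u = 0` (real there by `even₂` + `real₂`):
MDKP's `t¹ = 0` for both ground states, with the sign (`1 + d¹ > 0`); triage E3/F4. -/
def FusedCentralNonneg (Λ₂ : ℂ → ℂ) : Prop :=
  ∀ y : ℝ, (Λ₂ (Complex.I * y)).im = 0 ∧ 0 ≤ (Λ₂ (Complex.I * y)).re

/-- **The vesica pattern (C⁺ of the card, cut to what the NLIE uses; triage r1-3 (2)(3))** for the
sector `d = 2k` on `N` strands: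
* `offCentre₁`: in the CLOSED physical strip `0 ≤ Re u ≤ π/3`, `Λ¹` vanishes only on the central line;
* `count₁`, `simple₁`: exactly `t² = k` zeros of positive imaginary part there, all simple (the
  conjugate ones below by `real₁`; none real since `Λ¹(π/6) ≠ 0` by `iso`);
* `strip₂`, `simple₂`: in the closed strip `|Re u| ≤ π/6` the fused branch vanishes only at the two
  common real zeros `±π/6`, which are simple (`t¹ = 0`; `1 + K`, `1 + d¹` zero-free; `d¹` has neither
  pole nor zero at `±π/6`, MDKP §3.5);
* `subcaseB`: for `k = 2` (`d = 4 ≡ 1 mod 3`) MDKP's subcase B, stated convention-free on the central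
  line: `e^{4y}(1 - Λ¹/f₁)(π/6 + iy) → κ' > 0` (`1 + 𝔞² ∼ κ'e^{-4|x|/3}`, `x = 3y`; §3.5, §3.7). -/
structure VesicaPattern (N k : ℕ) (Λ₁ Λ₂ : ℂ → ℂ) : Prop where
  offCentre₁ : ∀ u : ℂ, 0 ≤ u.re → u.re ≤ Real.pi / 3 → Λ₁ u = 0 → u.re = Real.pi / 6
  count₁ : {u : ℂ | u.re = Real.pi / 6 ∧ 0 < u.im ∧ Λ₁ u = 0}.ncard = k
  simple₁ : ∀ u : ℂ, u.re = Real.pi / 6 → Λ₁ u = 0 → deriv Λ₁ u ≠ 0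
  strip₂ : ∀ u : ℂ, -(Real.pi / 6) ≤ u.re → u.re ≤ Real.pi / 6 → Λ₂ u = 0 → (u = uIso ∨ u = -uIso)
  simple₂ : deriv Λ₂ uIso ≠ 0
  subcaseB : k = 2 → ∃ κ : ℝ, 0 < κ ∧
    Tendsto (fun y : ℝ ↦ Real.exp (4 * y) *
      (1 - (Λ₁ (uIso + Complex.I * y) / fk N 1 (uIso + Complex.I * y)).re)) atTop (𝓝 κ)

/-- Half-width pairing `j(n) ≈ n/√2`: the diagonal strip of `N = 2·j(n)` columns has Euclidean width
`√2·j(n) = n + O(1)`, and `M = r·j(n)` double rows give aspect ratio exactly `r`. -/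
def jOf (n : ℕ) : ℕ := Nat.sqrt (n * n / 2)

/-- **Rotation comparison at 45°** for the `k`-cluster strip event: for every integer aspect ratio
`r ≥ 1`, the axis rectangle `[0, rn] × [0, n]` and the diagonal strip with `N = 2j(n)`, `M = r·j(n)`
(congruent quads at mesh `1/n` up to `O(1/n)`) have asymptotically equal `k`-cluster probabilities
under `P_{1/2}`.  Consequence of DKKMO (arXiv:2012.11672) at `q = 1`, `α = π/4`: Cor. 1.3
(`dkkmo_crossing_rotation_invariance`, tree) for `k = 1`; Thm 1.2 (`dkkmo_rotation_invariance`, loop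
form, tree) + Schramm–Smirnov continuity of the alternating open/dual/open 3-crossing event for `k = 2`;
plus the discrete-versus-continuum event comparison and `O(1)`-layer insensitivity (boundary 3-arm /
RSW). -/
def RotatedStripComparison (k : ℕ) : Prop :=
  ∀ r : ℕ, 1 ≤ r →
    Tendsto (fun n : ℕ ↦ pAxis k (r * n) n -
      (bondPercolation (zdGraph 2) half).real (diagEvent k (r * jOf n) (2 * jOf n))) atTop (𝓝 0)

/-! ## §1 Small certainties used by the composition -/

theorem kacExp_one : Real.pi * kacExp 1 = Real.pi / 3 := by
  simp [kacExp]; ring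

theorem kacExp_two : Real.pi * kacExp 2 = 2 * Real.pi := by
  simp [kacExp]; ring

/-- `sin λ ≠ 0` in `ℂ`. -/
theorem sin_lam_ne_zero : Complex.sin lam ≠ 0 := by
  unfold lam
  rw [← Complex.ofReal_sin, Complex.ofReal_ne_zero, Real.sin_pi_div_three]
  positivity

/-- `s₁(π/6) = sin(π/2)/sin(π/3) ≠ 0`. -/
theorem sk_one_uIso_ne_zero : sk 1 uIso ≠ 0 := by
  unfold sk uIso lam
  have h : ((Real.pi / 6 : ℝ) : ℂ) + ((1 : ℤ) : ℂ) * ((Real.pi / 3 : ℝ) : ℂ) = ((Real.pi / 2 : ℝ) : ℂ) := by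
    push_cast; ring
  rw [h, ← Complex.ofReal_sin, Real.sin_pi_div_two]
  simp only [Complex.ofReal_one, ne_eq, div_eq_zero_iff, one_ne_zero, false_or]
  exact sin_lam_ne_zero

/-- `f₁(π/6) = (-1)^N (4/3)^N ≠ 0`: the isotropic Razumov–Stroganov normaliser. -/
theorem fk_one_uIso_ne_zero (N : ℕ) : fk N 1 uIso ≠ 0 := by
  unfold fk
  exact mul_ne_zero (pow_ne_zero _ (by norm_num)) (pow_ne_zero _ sk_one_uIso_ne_zero)

/-- From the isotropic identification, `log ‖Λ¹(π/6)/f₁(π/6)‖ = -γ`. -/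
theorem log_norm_div_eq {N : ℕ} {Λ₁ : ℂ → ℂ} {γ : ℝ}
    (h : Λ₁ uIso = fk N 1 uIso * ((Real.exp (-γ) : ℝ) : ℂ)) :
    Real.log ‖Λ₁ uIso / fk N 1 uIso‖ = -γ := by
  have hf := fk_one_uIso_ne_zero N
  have hq : Λ₁ uIso / fk N 1 uIso = ((Real.exp (-γ) : ℝ) : ℂ) := by
    rw [h]; field_simp
  rw [hq, Complex.norm_real, Real.norm_eq_abs, abs_of_pos (Real.exp_pos _), Real.log_exp]

/-! ## §1b The sealing engine of the card, PROVED from the typed `T`-system (Lever (2))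

On the imaginary axis `u = iy` every factor of `tsystem` is an explicit real number:
`s₋₁(2iy)s₁(2iy) = -(sinh²2y + sin²λ)/sin²λ < 0`, `f₋₁f₁(iy) = ((sinh²y + sin²λ)/sin²λ)^{2N} > 0`,
`s₀(2iy)² = -sinh²2y/sin²λ ≤ 0`, `f₀(iy) = (sinh y/sin λ)^{2N} ≥ 0`.  Hence a zero of `Λ¹` at `iy`
would give `(positive) = (nonpositive)·Re Λ²(iy)`, impossible when `Λ²(iy) ≥ 0`: the fused branch's
sign on ITS central line seals the boundary `Re u ∈ {0, π/3}` of the physical strip of `Λ¹`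
(`noZero_boundary_of_fusedNonneg`, using `crossing₁` for the line `Re u = π/3`).  This is exactly the
use the composition makes of S3a inside S3b's hypothesis, now available to the lead as a theorem. -/

section Sealing

variable {N k : ℕ} {Λ₁ Λ₂ : ℂ → ℂ}

/-- `sin λ` as a real number (`= √3/2`). -/
def sinLam : ℝ := Real.sin (Real.pi / 3)

theorem sinLam_pos : 0 < sinLam := by
  unfold sinLam; rw [Real.sin_pi_div_three]; positivity

theorem sin_lam_eq : Complex.sin lam = (sinLam : ℂ) := by
  unfold lam sinLam; exact (Complex.ofReal_sin _).symm

/-- `sin(a+b)·sin(a-b) = sin²a - sin²b`. -/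
theorem sin_add_mul_sin_sub (a b : ℂ) :
    Complex.sin (a + b) * Complex.sin (a - b) = Complex.sin a ^ 2 - Complex.sin b ^ 2 := by
  rw [Complex.sin_add, Complex.sin_sub]
  have h1 := Complex.cos_sq' a
  have h2 := Complex.cos_sq' b
  linear_combination (Complex.sin a) ^ 2 * h2 - (Complex.sin b) ^ 2 * h1

theorem sin_I_mul (y : ℝ) : Complex.sin (Complex.I * y) = (Real.sinh y : ℂ) * Complex.I := by
  rw [mul_comm, Complex.sin_mul_I, ← Complex.ofReal_sinh]

theorem sin_two_I_mul (y : ℝ) :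
    Complex.sin (2 * (Complex.I * y)) = (Real.sinh (2 * y) : ℂ) * Complex.I := by
  have : (2 : ℂ) * (Complex.I * y) = Complex.I * (((2 * y : ℝ)) : ℂ) := by push_cast; ring
  rw [this, sin_I_mul]

theorem negOnePow_mul_self : ((-1 : ℂ) ^ N) * ((-1 : ℂ) ^ N) = 1 := by
  rw [← pow_add, ← two_mul, pow_mul]; norm_num

/-- `s₋₁(2iy)·s₁(2iy) = (-sinh²2y - sin²λ)/sin²λ`. -/
theorem sk_neg_one_mul_sk_one_two_I (y : ℝ) :
    sk (-1) (2 * (Complex.I * y)) * sk 1 (2 * (Complex.I * y)) =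
      (((-(Real.sinh (2 * y)) ^ 2 - sinLam ^ 2) / sinLam ^ 2 : ℝ) : ℂ) := by
  unfold sk
  have h1 : 2 * (Complex.I * y) + ((-1 : ℤ) : ℂ) * lam = 2 * (Complex.I * y) - lam := by push_cast; ring
  have h2 : 2 * (Complex.I * y) + ((1 : ℤ) : ℂ) * lam = 2 * (Complex.I * y) + lam := by push_cast; ring
  rw [h1, h2, div_mul_div_comm, mul_comm (Complex.sin (2 * (Complex.I * ↑y) - lam)),
    sin_add_mul_sin_sub, sin_two_I_mul, sin_lam_eq, mul_pow, Complex.I_sq]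
  have hS : (sinLam : ℂ) ≠ 0 := Complex.ofReal_ne_zero.2 sinLam_pos.ne'
  push_cast
  field_simp

/-- `s₀(2iy)² = -sinh²2y/sin²λ`. -/
theorem sk_zero_two_I_sq (y : ℝ) :
    sk 0 (2 * (Complex.I * y)) ^ 2 = ((-(Real.sinh (2 * y)) ^ 2 / sinLam ^ 2 : ℝ) : ℂ) := by
  unfold sk
  have h0 : 2 * (Complex.I * y) + ((0 : ℤ) : ℂ) * lam = 2 * (Complex.I * y) := by push_cast; ring
  rw [h0, sin_two_I_mul, sin_lam_eq, div_pow, mul_pow, Complex.I_sq]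
  have hS : (sinLam : ℂ) ≠ 0 := Complex.ofReal_ne_zero.2 sinLam_pos.ne'
  push_cast
  field_simp

/-- `f₀(iy) = (sinh y/sin λ)^{2N}`. -/
theorem fk_zero_I (y : ℝ) :
    fk N 0 (Complex.I * y) = (((Real.sinh y / sinLam) ^ (2 * N) : ℝ) : ℂ) := by
  unfold fk sk
  have h0 : Complex.I * y + ((0 : ℤ) : ℂ) * lam = Complex.I * y := by push_cast; ring
  rw [h0, sin_I_mul, sin_lam_eq]
  have hrw : ((Real.sinh y : ℂ) * Complex.I / (sinLam : ℂ)) = ((Real.sinh y : ℂ) / sinLam) * Complex.I := by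
    ring
  rw [hrw, mul_pow, pow_mul Complex.I 2 N, Complex.I_sq, Complex.ofReal_pow, Complex.ofReal_div]
  calc (-1 : ℂ) ^ N * (((Real.sinh y : ℂ) / sinLam) ^ (2 * N) * (-1) ^ N)
      = ((-1 : ℂ) ^ N * (-1) ^ N) * ((Real.sinh y : ℂ) / sinLam) ^ (2 * N) := by ring
    _ = ((Real.sinh y : ℂ) / sinLam) ^ (2 * N) := by rw [negOnePow_mul_self, one_mul]

/-- `f₋₁(iy)·f₁(iy) = ((sinh²y + sin²λ)/sin²λ)^{2N}`. -/
theorem fk_neg_one_mul_fk_one_I (y : ℝ) :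
    fk N (-1) (Complex.I * y) * fk N 1 (Complex.I * y) =
      ((((Real.sinh y) ^ 2 + sinLam ^ 2) / sinLam ^ 2) ^ (2 * N) : ℝ) := by
  unfold fk sk
  have h1 : Complex.I * y + ((-1 : ℤ) : ℂ) * lam = Complex.I * y - lam := by push_cast; ring
  have h2 : Complex.I * y + ((1 : ℤ) : ℂ) * lam = Complex.I * y + lam := by push_cast; ring
  rw [h1, h2]
  have hS : (sinLam : ℂ) ≠ 0 := Complex.ofReal_ne_zero.2 sinLam_pos.ne'
  have hprod : Complex.sin (Complex.I * y - lam) / Complex.sin lam *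
      (Complex.sin (Complex.I * y + lam) / Complex.sin lam) =
        ((-(((Real.sinh y) ^ 2 + sinLam ^ 2) / sinLam ^ 2) : ℝ) : ℂ) := by
    rw [div_mul_div_comm, mul_comm (Complex.sin (Complex.I * ↑y - lam)), sin_add_mul_sin_sub,
      sin_I_mul, sin_lam_eq, mul_pow, Complex.I_sq]
    push_cast
    field_simp
    ring
  calc (-1 : ℂ) ^ N * (Complex.sin (Complex.I * y - lam) / Complex.sin lam) ^ (2 * N) *
        ((-1) ^ N * (Complex.sin (Complex.I * y + lam) / Complex.sin lam) ^ (2 * N))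
      = ((-1 : ℂ) ^ N * (-1) ^ N) * (Complex.sin (Complex.I * y - lam) / Complex.sin lam *
          (Complex.sin (Complex.I * y + lam) / Complex.sin lam)) ^ (2 * N) := by rw [mul_pow]; ring
    _ = ((-(((Real.sinh y) ^ 2 + sinLam ^ 2) / sinLam ^ 2) : ℝ) : ℂ) ^ (2 * N) := by
        rw [negOnePow_mul_self, one_mul, hprod]
    _ = ((((Real.sinh y) ^ 2 + sinLam ^ 2) / sinLam ^ 2) ^ (2 * N) : ℝ) := by
        push_cast
        rw [pow_mul, pow_mul, neg_sq]

/-- **Sealing, imaginary axis.** If the pair satisfies the typed `T`-system and the fused branch is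
real nonnegative on `Re u = 0`, then `Λ¹` has no zero on `Re u = 0`. -/
theorem noZero_imagAxis_of_fusedNonneg (h : IsD3Pair N k Λ₁ Λ₂) (hF : FusedCentralNonneg Λ₂)
    (y : ℝ) : Λ₁ (Complex.I * y) ≠ 0 := by
  intro h0
  have hT := h.tsystem (Complex.I * y)
  rw [h0, zero_mul, zero_sub, sk_neg_one_mul_sk_one_two_I, fk_neg_one_mul_fk_one_I, sk_zero_two_I_sq,
    fk_zero_I] at hT
  obtain ⟨him, hre⟩ := hF y
  have hre_eq := congrArg Complex.re hT
  simp only [Complex.mul_re, Complex.neg_re, Complex.neg_im, Complex.ofReal_re, Complex.ofReal_im,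
    mul_zero, sub_zero, zero_mul, him] at hre_eq
  -- signs of the explicit real factors
  have hS := sinLam_pos
  have hS2 : 0 < sinLam ^ 2 := by positivity
  have ha : (-(Real.sinh (2 * y)) ^ 2 - sinLam ^ 2) / sinLam ^ 2 < 0 := by
    apply div_neg_of_neg_of_pos _ hS2
    nlinarith [sq_nonneg (Real.sinh (2 * y))]
  have hP : 0 < (((Real.sinh y) ^ 2 + sinLam ^ 2) / sinLam ^ 2) ^ (2 * N) := by positivity
  have hb : -(Real.sinh (2 * y)) ^ 2 / sinLam ^ 2 ≤ 0 :=
    div_nonpos_of_nonpos_of_nonneg (neg_nonpos.2 (sq_nonneg _)) hS2.le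
  have hQ : 0 ≤ (Real.sinh y / sinLam) ^ (2 * N) := by
    rw [pow_mul]; exact pow_nonneg (sq_nonneg _) N
  have hQre : 0 ≤ (Real.sinh y / sinLam) ^ (2 * N) * (Λ₂ (Complex.I * y)).re := mul_nonneg hQ hre
  nlinarith

/-- **Sealing of the physical strip's boundary.** Under S3a's conclusion, `Λ¹` has no zero on the two
boundary lines `Re u = 0` and `Re u = π/3` (the second by `crossing₁`). -/
theorem noZero_boundary_of_fusedNonneg (h : IsD3Pair N k Λ₁ Λ₂) (hF : FusedCentralNonneg Λ₂)
    (y : ℝ) : Λ₁ (Complex.I * y) ≠ 0 ∧ Λ₁ (lam + Complex.I * y) ≠ 0 := by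
  refine ⟨noZero_imagAxis_of_fusedNonneg h hF y, ?_⟩
  have hc : lam + Complex.I * y = lam - Complex.I * (((-y : ℝ)) : ℂ) := by push_cast; ring
  rw [hc, h.crossing₁]
  exact noZero_imagAxis_of_fusedNonneg h hF (-y)

/-- **Rigidity witness (non-vacuity of the typed relations, triage r1-3 (1)).** The cleared-denominator
`T`-system alone forces the common zero of the fused branch at the isotropic point, `Λ²(π/6) = 0`
(MDKP §3.5: "all the eigenvalues of `D²(u)` share single real zeros at `u = ±π/6, ±π/3`"), because
`s₋₁(2·π/6) = sin 0 = 0` while `s₀(π/3) = 1` and `f₀(π/6) = (-1)^N 3^{-N} ≠ 0`. -/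
theorem fused_uIso_eq_zero (h : IsD3Pair N k Λ₁ Λ₂) : Λ₂ uIso = 0 := by
  have hT := h.tsystem uIso
  have hz : sk (-1) (2 * uIso) = 0 := by
    unfold sk uIso lam
    have : 2 * ((Real.pi / 6 : ℝ) : ℂ) + ((-1 : ℤ) : ℂ) * ((Real.pi / 3 : ℝ) : ℂ) = 0 := by
      push_cast; ring
    rw [this, Complex.sin_zero, zero_div]
  have h0 : sk 0 (2 * uIso) ≠ 0 := by
    unfold sk uIso
    have : 2 * ((Real.pi / 6 : ℝ) : ℂ) + ((0 : ℤ) : ℂ) * lam = lam := by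
      unfold lam; push_cast; ring
    rw [this]
    exact div_ne_zero sin_lam_ne_zero sin_lam_ne_zero
  have hf : fk N 0 uIso ≠ 0 := by
    unfold fk sk uIso
    have : ((Real.pi / 6 : ℝ) : ℂ) + ((0 : ℤ) : ℂ) * lam = ((Real.pi / 6 : ℝ) : ℂ) := by
      push_cast; ring
    rw [this]
    refine mul_ne_zero (pow_ne_zero _ (by norm_num)) (pow_ne_zero _ (div_ne_zero ?_ sin_lam_ne_zero))
    rw [← Complex.ofReal_sin, Complex.ofReal_ne_zero, Real.sin_pi_div_six]
    norm_num
  rw [hz, zero_mul, zero_mul] at hT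
  -- hT : 0 = sk 0 (2 uIso)^2 * fk N 0 uIso * Λ₂ uIso
  have := mul_eq_zero.1 hT.symm
  rcases this with h1 | h2
  · exact absurd h1 (mul_ne_zero (pow_ne_zero _ h0) hf)
  · exact h2

end Sealing

/-! ## §2 The six registered stubs -/

/-- **S2 `stub_sectorPerronBranches`** (XL; known in print + identification).  For `k ∈ {1,2}` there is
a family of sector Perron pairs `(Λ¹ⱼ, Λ²ⱼ)` on `N = 2j ≥ 4` strands.  Why true: take `Λ¹ⱼ(u)` = the
eigenvalue of MDKP's `D(u)` (BPO'B double-row tangle on the standard module `W_{2k}` of `TL_{2j}(1)`)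
on the entrywise-positive common eigenvector of the commuting family (Perron vector of `D(u)`,
`u ∈ (0,λ)`, `u`-independent by commutation + simplicity), `Λ²ⱼ` likewise for `D²(u)`: Laurent form and
degree (MDKP §3.5), reality, crossing `D(λ-u) = D(u)`, `D²(-u) = D²(u)` (§3.1, §3.3), `T`-system and
closure (MDPR14, diagrammatic theorems holding in every module, §3.3–3.4), braid scalar (MDPR14;
§3.5 eq. (braid01/02)); identification: the column-staggered model's two-layer stochastic matrix is
`D(u)/s₁(u)^{2N}` (face weights `s₁(-u), s₀(u)`, total `s₁(-u)+s₀(u) = s₁(u)`; RS eigenvalue `f₁` =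
vacuum normaliser), and the `k`-cluster rate is minus log of the Perron value of the `k`-marked block
(block-triangularity in the number of marked clusters, positive boundary overlaps; `W₄`'s Perron vector
is positive hence outside the radical — triage F1).  Size XL formally (TL standard modules, the tangle,
YBE/BYBE commutation, fusion: none in tree; `transferLin_eq_noncommProd`, `TemperleyLieb.tlE` exist for
the axis word only).  Sources: BehrendPearceOBrien1996; MDPR14 = arXiv:1401.7750; MDKP17 =
arXiv:1701.08167 §3.1–3.5; DiFrancesco–Zinn-Justin / de Gier et al. for `β = 1` module structure. -/
theorem stub_sectorPerronBranches :
    ∀ k : ℕ, (k = 1 ∨ k = 2) →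
      ∃ Λ₁ Λ₂ : ℕ → ℂ → ℂ, ∀ j : ℕ, 2 ≤ j → IsSectorPerronPair (2 * j) k (Λ₁ j) (Λ₂ j) := by
  sorry

/-- **S3a `stub_fusedCentralNonneg`** (M–L; new, finite-`N`, decidable per `N` by Sturm sequences).
The fused Perron branch is real and nonnegative on the imaginary axis (its central line): MDKP's
`t¹ = 0` for the ground states of `W₂`, `W₄` (§3.7) together with the sign `1 + d¹ > 0` (§3.5, "real
but never zero … positive everywhere"); triage E3 (`N ≤ 10`, `y ∈ [0.3, 5.9]`) and F4 (`N ≤ 12`).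
Role: by `tsystem` + `crossing₁` + `real₁`, on `u = iy` one has the exact identity
`|Λ¹(iy)|² = |f₁(iy)|² + Ψ(y)Λ²(iy)`, `Ψ(y) = sinh²(2y)(sinh y/sin λ)^{2N}/|s₁(2iy)|² ≥ 0`, so this stub
seals the boundary `Re u ∈ {0, π/3}` of the physical strip against zeros of `Λ¹` at every `N` (card,
Lever (2); triage r1-1/2/3 re-derived it).  Why it might fail: it is itself an analyticity datum; the
bet (card, Barriers (a)) is a joint homotopy for the pair, the mirror identity from `closure` tying
zeros of `Λ²` on `Re u = ±π/6` to `Λ¹ < f₁` on the central line ("vacuum domination"). -/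
theorem stub_fusedCentralNonneg :
    ∀ (j k : ℕ) (Λ₁ Λ₂ : ℂ → ℂ), (k = 1 ∨ k = 2) → 2 ≤ j →
      IsSectorPerronPair (2 * j) k Λ₁ Λ₂ → FusedCentralNonneg Λ₂ := by
  sorry

/-- **S3b `stub_vesicaPattern`** (L; THE load-bearing new stub = the card's C⁺, cut to size).  Given the
sealed boundary (S3a), the ground-state pattern of MDKP §3.7 in the form the NLIE consumes: `Λ¹`'s zeros
in the closed physical strip lie on `Re u = π/6`, exactly `k` of them with `Im u > 0`, simple; `Λ²` is
zero-free in `|Re u| ≤ π/6` except the simple common zeros `±π/6`; subcase B for `k = 2`.  TRUE for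
`N = 4, …, 12` (triage r1-1 `dtangle_mine.py`, r1-2 E3, r1-3 F3: margin `≥ π/6` — all other zeros at
`Re u/π ∈ [-0.178, -0.167] ∪ [0.50, 0.51]`).  Mechanism (card, Lever (3)): with the boundary sealed
the count inside is a homotopy invariant — in `N` via the size recursion at `z_{i+1} = q²z_i`
(Di Francesco 2005 / de Gier–Ponsaing–Shigechi 2009, open boundaries) or along inhomogeneities, from
the one-dimensional modules `N = d`; central-line anchors: `Λ¹(π/6) > 0` (Perron), braid sign.  Why it
might fail: level crossing of the continued Perron eigenvalue along the homotopy path (simplicity), or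
an off-axis vesica zero at some `N > 12`; subcase B (`c_{-N+1} = c^{RS}_{-N+1}` for the `W₄` ground
state) is MDKP-empirical.  Cheapest falsifier: exact zero location for `N = 14, 16` and the coefficient
test for subcase B at `N = 4, 6, 8`. -/
theorem stub_vesicaPattern :
    ∀ (j k : ℕ) (Λ₁ Λ₂ : ℂ → ℂ), (k = 1 ∨ k = 2) → 2 ≤ j →
      IsSectorPerronPair (2 * j) k Λ₁ Λ₂ → FusedCentralNonneg Λ₂ → VesicaPattern (2 * j) k Λ₁ Λ₂ := by
  sorry

/-- **S4 `stub_scalingTBA`** (XL; MDKP §3.6–3.7 made rigorous, the `N → ∞` half of the line).  For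
every family of sector Perron pairs carrying the sealed vesica pattern eventually in `j`,
`2j·log(Λ¹ⱼ(π/6)/f₁(π/6)) → -2π·hₖ`, `h₁ = 1/3`, `h₂ = 2`.  Content: `D = D_b D_s D_f` with `D_b = f₁`
(RS eigenvalue; its `1/N` corrections vanish exactly), `D_s = 1` at `β = 1`; `𝔟(x) = D_f(π/6 + ix/3)`
satisfies `𝔟(x - iπ/2)𝔟(x + iπ/2) = 𝔄¹(x)`; with `offCentre₁`/`strip₂` (ANZ of `ℓ¹, ℓ², 𝔄¹, 𝔄²` in
`|Im x| ≤ π/2`) Fourier analysis gives the NLIE (MDKP eq. TBA), the scaling limit `x = ln N + O(1)`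
(to be PROVED: existence/uniqueness of the scaling NLIE solution — card `scaling-tba-positive-logs`,
whose typed `∃!` needs the triage repair `𝖺²(y) = 0` pinned; numerically a contraction with
`Δ = 1/3 + 4·10⁻⁶`, triage r1-1/r1-3, kit j010139/j010149), the quantisation integers `k^j = j`
(certifiable numerically since integer-valued), constants from `laurent₁` (braid) and `subcaseB`, and
the dilogarithm evaluation `𝒥 = 4π²/3` (`k = 1`) / `0` (`k = 2`) giving `Δ = Σk^j + τ = 1/3, 2`.  Why
it might fail: the scaling-limit step needs a-priori tightness (available here: RSW gives
`N·γ◇ₖ(N) = O(1)`), and MDKP's derivation has never been made rigorous for open boundaries (template: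
Kozlowski2018, periodic XXZ).  Sources: MDKP17 §3.6–3.7; KluemperPearce1992; Kozlowski2018 =
arXiv:1508.05741. -/
theorem stub_scalingTBA :
    ∀ k : ℕ, (k = 1 ∨ k = 2) → ∀ (Λ₁ Λ₂ : ℕ → ℂ → ℂ),
      (∀ᶠ j : ℕ in atTop, IsSectorPerronPair (2 * j) k (Λ₁ j) (Λ₂ j) ∧
        FusedCentralNonneg (Λ₂ j) ∧ VesicaPattern (2 * j) k (Λ₁ j) (Λ₂ j)) →
      Tendsto (fun j : ℕ ↦ (2 * j : ℝ) * Real.log ‖Λ₁ j uIso / fk (2 * j) 1 uIso‖) atTop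
        (𝓝 (-(2 * Real.pi * kacExp k))) := by
  sorry

/-- **B1 `stub_rotatedStripComparison`** (L given the vendored DKKMO facts; XL from scratch).  Why
true: DKKMO (arXiv:2012.11672) at `q = 1`.  `k = 1`: Cor. 1.3 per quad (tree fact
`dkkmo_crossing_rotation_invariance`, `α = π/4 ∈ (ε, π - ε)`) for `Q = [0,r]×[0,1]` at mesh `1/n`,
plus: the Schramm–Smirnov event `𝒞_δ(Q)` vs the discrete events `lrCrossing (rn) n` /
`diagOneEvent`, and `O(1)`-lattice-layer changes of the quad, differ by `o(1)` (boundary 3-arm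
exponent `2 > 1`, RSW — standard).  `k = 2`: two distinct spanning clusters ⟺ open / closed-dual / open
alternating crossings (planar duality inside the quad); closeness of the loop laws in `d_CN`
(`dkkmo_rotation_invariance`, Thm 1.2) or of the Schramm–Smirnov laws, plus a.s. continuity of that
3-crossing event under any sub-sequential limit (arm separation; the tree's `ArmSeparation*`), gives
`o(1)`.  Why it might fail: only through the vendored facts (theorems in print) or a gap in the
continuity lemma for `k = 2` (triage r1-1/r1-3 name it as the honest extra cost).  Sources:
DKKMO2020Rotational Cor. 1.3 / Thm 1.2; SchrammSmirnov2011 §1.3; Tassion Bourbaki Exp. 1210. -/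
theorem stub_rotatedStripComparison :
    ∀ k : ℕ, (k = 1 ∨ k = 2) → RotatedStripComparison k := by
  sorry

/-- **B2 `stub_feketeTransfer`** (L; provable now with tree RSW — `rsw_half_holds`,
`crossingProb_half_succ_self_holds`, `harris_fkg_holds`, `crossingProb_long_le`, BK/Reimer).  If the axis
rates exist, the diagonal rates exist eventually and `2j·γ◇ₖ(2j) → 2π hₖ`, and the 45° comparison
holds, then `n·γₖ(n) → π hₖ`.  Proof shape (card `diagonal-strip-dkkmo-transfer`, triage: pass): both
orientations satisfy `pₖ(m₁+m₂+1) ≤ pₖ(m₁)pₖ(m₂)` (restriction to edge-disjoint blocks, independence;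
note `pₖ` is non-increasing in the length) and `pₖ(m₁+m₂+w) ≥ c·pₖ(m₁)pₖ(m₂)` with `c > 0` UNIFORM in
the width `w` (`k = 1`: Harris–FKG gluing through a top–bottom crossing of the `w × w` overlap,
probability `≥ 1/2`; `k = 2`: glue the two clusters and the dual separator across the overlap — an
arm-separation lemma in the strip, the genuinely new piece), whence the sandwich
`w·γ(w) ∈ [(-log P(r))/r · (1 - O(1/r)), (-log P(r) + C)/(r - 1)]` at aspect `r`, in both geometries
(units: axis `n·γ₁ ↔ -log p(rn,n)/r`; diagonal `2j·γ◇ ↔ 2(-log q(rj,2j))/r`); RSW lower bounds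
`P ≥ e^{-Cr}` turn B1's additive `o(1)` into `o(1)` of logs; squeeze and `r → ∞`.  Honours Disproof §3:
no per-width claim.  Sources: Grimmett1999 §11; BollobasRiordan2006 Ch. 3; Aizenman1997 Thm 3;
SmirnovWerner2001 (half-plane arm separation). -/
theorem stub_feketeTransfer :
    ∀ k : ℕ, (k = 1 ∨ k = 2) → ∀ (γ γd : ℕ → ℝ),
      (∀ n : ℕ, 1 ≤ n → Tendsto (fun m : ℕ ↦ -Real.log (pAxis k m n) / (m : ℝ)) atTop (𝓝 (γ n))) →
      (∀ᶠ j : ℕ in atTop, Tendsto (diagRateSeq (bondPercolation (zdGraph 2) half) k (2 * j)) atTop (𝓝 (γd j))) →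
      Tendsto (fun j : ℕ ↦ (2 * j : ℝ) * γd j) atTop (𝓝 (2 * Real.pi * kacExp k)) →
      RotatedStripComparison k →
      Tendsto (fun n : ℕ ↦ (n : ℝ) * γ n) atTop (𝓝 (Real.pi * kacExp k)) := by
  sorry

/-! ## §3 The composition: the six stubs (+ the support item `StripRatesExist`) give the crux BY NAME -/

/-- The diagonal limit `2j·γ◇ₖ(2j) → 2π hₖ` from S2–S4, with rates read off the isotropic
identification. -/
theorem diag_limit (k : ℕ) (hk : k = 1 ∨ k = 2) :
    ∃ γd : ℕ → ℝ,
      (∀ᶠ j : ℕ in atTop, Tendsto (diagRateSeq (bondPercolation (zdGraph 2) half) k (2 * j)) atTop (𝓝 (γd j))) ∧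
      Tendsto (fun j : ℕ ↦ (2 * j : ℝ) * γd j) atTop (𝓝 (2 * Real.pi * kacExp k)) := by
  obtain ⟨Λ₁, Λ₂, hΛ⟩ := stub_sectorPerronBranches k hk
  have hiso : ∀ j : ℕ, 2 ≤ j → ∃ γ : ℝ,
      Tendsto (diagRateSeq (bondPercolation (zdGraph 2) half) k (2 * j)) atTop (𝓝 γ) ∧
        Λ₁ j uIso = fk (2 * j) 1 uIso * ((Real.exp (-γ) : ℝ) : ℂ) := fun j hj ↦ (hΛ j hj).iso
  choose! γd hγd using hiso
  refine ⟨γd, ?_, ?_⟩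
  · filter_upwards [eventually_ge_atTop 2] with j hj using (hγd j hj).1
  · have hall : ∀ᶠ j : ℕ in atTop, IsSectorPerronPair (2 * j) k (Λ₁ j) (Λ₂ j) ∧
        FusedCentralNonneg (Λ₂ j) ∧ VesicaPattern (2 * j) k (Λ₁ j) (Λ₂ j) := by
      filter_upwards [eventually_ge_atTop 2] with j hj
      have hP := hΛ j hj
      have hF := stub_fusedCentralNonneg j k (Λ₁ j) (Λ₂ j) hk hj hP
      exact ⟨hP, hF, stub_vesicaPattern j k (Λ₁ j) (Λ₂ j) hk hj hP hF⟩
    have hT := stub_scalingTBA k hk Λ₁ Λ₂ hall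
    have hEq : (fun j : ℕ ↦ (2 * j : ℝ) * γd j) =ᶠ[atTop]
        fun j : ℕ ↦ -((2 * j : ℝ) * Real.log ‖Λ₁ j uIso / fk (2 * j) 1 uIso‖) := by
      filter_upwards [eventually_ge_atTop 2] with j hj
      rw [log_norm_div_eq (hγd j hj).2]; ring
    rw [tendsto_congr' hEq]
    simpa using hT.neg

/-- **`StripClusterRates` from the line `vesica-zero-free-perron-branch`** (kernel-checked, no `sorry`
of its own; the only non-stub hypothesis is the route's support item `StripRatesExist`, stmt-13879,
provable now).  Axis rates from the support item; for each `k ∈ {1,2}` the diagonal limit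
(`diag_limit`: S2, S3a, S3b, S4) is carried to the axis strip by B2 with B1; `π·h₁ = π/3`,
`π·h₂ = 2π`. -/
theorem StripClusterRates_of (hE : StripRatesExist) : StripClusterRates := by
  have h1 : ∀ n : ℕ, 1 ≤ n → ∃ γ : ℝ,
      Tendsto (fun m : ℕ ↦ -Real.log (crossingProb half m n) / (m : ℝ)) atTop (𝓝 γ) :=
    fun n hn ↦ (hE n hn).1
  have h2 : ∀ n : ℕ, 1 ≤ n → ∃ γ : ℝ,
      Tendsto (fun m : ℕ ↦ -Real.log ((bondPercolation (zdGraph 2) half).real (twoClusterEvent m n)) / (m : ℝ))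
        atTop (𝓝 γ) :=
    fun n hn ↦ (hE n hn).2
  choose! γ₁ hγ₁ using h1
  choose! γ₂ hγ₂ using h2
  -- k = 1
  obtain ⟨γd₁, hd₁, hlim₁⟩ := diag_limit 1 (Or.inl rfl)
  have hax₁ : ∀ n : ℕ, 1 ≤ n → Tendsto (fun m : ℕ ↦ -Real.log (pAxis 1 m n) / (m : ℝ)) atTop (𝓝 (γ₁ n)) := by
    intro n hn; simpa [pAxis] using hγ₁ n hn
  have hone := stub_feketeTransfer 1 (Or.inl rfl) γ₁ γd₁ hax₁ hd₁ hlim₁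
    (stub_rotatedStripComparison 1 (Or.inl rfl))
  rw [kacExp_one] at hone
  -- k = 2
  obtain ⟨γd₂, hd₂, hlim₂⟩ := diag_limit 2 (Or.inr rfl)
  have hax₂ : ∀ n : ℕ, 1 ≤ n → Tendsto (fun m : ℕ ↦ -Real.log (pAxis 2 m n) / (m : ℝ)) atTop (𝓝 (γ₂ n)) := by
    intro n hn; simpa [pAxis] using hγ₂ n hn
  have htwo := stub_feketeTransfer 2 (Or.inr rfl) γ₂ γd₂ hax₂ hd₂ hlim₂
    (stub_rotatedStripComparison 2 (Or.inr rfl))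
  rw [kacExp_two] at htwo
  exact ⟨γ₁, γ₂, hγ₁, hγ₂, hone, htwo⟩

end Summit.CriticalPhenomena.CardyFormulaZ2.Cruxes.StripClusterRates.VesicaZeroFreePerronBranch

end
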